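import Mathlib
import Summits.Ventures.PercRepro2.HCov
import Summits.Ventures.PercRepro2.EdgeCubic
import Summits.Ventures.PercRepro2.KPrimePendantLemmas
import Summits.Ventures.PercRepro2.FirstOrderTerms
import Summits.Ventures.PercRepro2.FirstOrderPendantClosed
import Summits.Ventures.PercRepro2.FirstOrderRoot
import Summits.Ventures.PercRepro2.FirstOrderPendant

/-!
# The degree-one-root contraction, one inequality away (blind cell PercRepro2, p5 g21;
`proofs/P5-OEDGE.md` §27)

At a pendant root edge `e = {a₂, z}` the closed pin has `Gc = 0` (**`Gc_closed_pendant_eq_zero`**: the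
twelve closed-pin masses of `FirstOrderPendantClosed.lean`, then `ring`) and `B1 ≥ 0`
(`B1_nonneg_pendant_root`).  Hence, by the one-edge cubic (`EdgeCubic.HCov_of_update_zero_of_bern`),

**`HCov_pendant_root_of_B2`**: (HCOV) at the contraction (`a₂ := z`, the open pin) together with
`0 ≤ B2` at the edge gives (HCOV) at the pendant instance for EVERY weight of the edge.  The
two-copy coefficient `B2 ≥ 0` at pendant root edges is the one open inequality of the class
(census 0 negatives; `P5-OEDGE.md` §27 (3)); it is NOT claimed here.
-/

namespace Summit.Ventures.PercRepro2

open UnionCluster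

namespace CovForm

namespace FirstOrder

section Class

variable {V : Type*} {E : Type*} [Fintype E] [DecidableEq E] [Fintype V] [DecidableEq V]
  {R : Type*} [Field R] [LinearOrder R] [IsStrictOrderedRing R]
variable {ends : E → Sym2 V} {p : E → R} {e : E} {a₂ z : V}

omit [Fintype V] [DecidableEq V] in
/-- **`Gc = 0` at the closed pin of a pendant root edge** (the root isolated: one trivial cluster). -/
theorem Gc_closed_pendant_eq_zero (hleaf : ∀ f, a₂ ∈ ends f → f = e) {o a₁ a₃ b : V} (ho : o ≠ a₂)
    (h1 : a₁ ≠ a₂) (h3 : a₃ ≠ a₂) (hb : b ≠ a₂) :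
    Gc (Function.update p e 0) ends o a₁ a₂ a₃ b = 0 := by
  unfold Gc DEF
  rw [closed_Q hleaf h1, closed_PD hleaf h1 h3, closed_Do hleaf ho h1 h3, closed_EQbo hleaf ho h1 hb a₃,
    closed_EQb3 hleaf h1 h3 hb, closed_EQb3o hleaf ho h1 h3 hb, closed_EQo hleaf ho h1 a₃,
    closed_EQ3 hleaf h1 h3, closed_EQ3o hleaf ho h1 h3, closed_PDb hleaf h1 h3 hb,
    closed_PDbo hleaf ho h1 h3 hb, closed_gap hleaf h1 hb a₃]
  ring

omit [Fintype V] [DecidableEq V] in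
/-- (HCOV) holds at the closed pin of a pendant root edge. -/
theorem HCov_closed_pendant (hleaf : ∀ f, a₂ ∈ ends f → f = e) {o a₁ a₃ b : V} (ho : o ≠ a₂)
    (h1 : a₁ ≠ a₂) (h3 : a₃ ≠ a₂) (hb : b ≠ a₂) :
    HCov (Function.update p e 0) ends o a₁ a₂ a₃ b := by
  unfold HCov
  rw [Gc_closed_pendant_eq_zero hleaf ho h1 h3 hb]

/-- **THE DEGREE-ONE-ROOT CONTRACTION, ONE INEQUALITY AWAY**: at a pendant root edge `e = {a₂, z}`,
(HCOV) at the contraction (the open pin, `a₂ ≡ z`) and `0 ≤ B2` at `e` give (HCOV) at the pendant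
instance, at every weight of the edge — `Gc₀ = 0` and `B1 ≥ 0` being theorems. -/
theorem HCov_pendant_root_of_B2 (hp : IsProbVec p) (he : p e ≠ 1) (hleaf : ∀ f, a₂ ∈ ends f → f = e)
    (hends : ends e = s(a₂, z)) {o a₁ a₃ b : V} (ho : o ≠ a₂) (h1 : a₁ ≠ a₂) (h3 : a₃ ≠ a₂)
    (hb : b ≠ a₂) (h₁ : HCov (Function.update p e 1) ends o a₁ a₂ a₃ b)
    (hB2 : 0 ≤ EdgeLine.B2 p ends o a₁ a₂ a₃ b e) :
    HCov p ends o a₁ a₂ a₃ b :=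
  EdgeLine.HCov_of_update_zero_of_bern p hp ends o a₁ a₂ a₃ b e (HCov_closed_pendant hleaf ho h1 h3 hb)
    h₁ (B1_nonneg_pendant_root hp he hleaf hends ho h1 h3 hb) hB2

end Class

end FirstOrder

end CovForm

end Summit.Ventures.PercRepro2
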